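import Literature.ComputerArithmetic.JeannerodRump2018.OptimalBound
import Mathlib.Algebra.BigOperators.Group.List.Basic
import Mathlib.Algebra.Order.BigOperators.Group.List

/-!
# Jeannerod–Rump Theorem 4.1 PROVED: any-order floating-point summation, `Σ|eᵢ| ≤ (n-1)u/(1+u)·Σ|xᵢ|`

HONEST FRAMING (venture CertifiedArithmetic / cell `pub-lowprec`): certified error envelopes and
provably optimal rounding/accumulation schemes for low-precision formats under stated cost models;
every table by two implementations; no hardware or vendor claims.

We DISCHARGE the named facts `theorem41` and `sumError_le` of `Summation.lean`
([JeannerodRump2018, Thm 4.1 and eq. (1.3)]): for floats `x₁ … xₙ ∈ F` (precision `p ≥ 1`,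
gradual underflow, no overflow) and ANY evaluation order (binary tree), with ANY round-to-nearest
`fl`, the local errors satisfy `Σ|eᵢ| ≤ (n-1)·u/(1+u)·Σ|xᵢ|` and hence
`|ŝ - s| ≤ (n-1)·u/(1+u)·Σ|xᵢ|` — no restriction on `n`. Proof as in [JeannerodRump2018,
Appendix B]: induction on the tree; at the root `ŝ = fl(ŝ₁ + ŝ₂)` the local error is bounded
three ways — by `u/(1+u)·|ŝ₁ + ŝ₂|` (`abs_err_add_le_sharp`), by `|ŝ₁|` and by `|ŝ₂|`
(`abs_err_le_abs_operand`) — and one of the three cases `S₂ < u'S₁`, `S₁ < u'S₂`, "neither"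
(`Sⱼ = Σ_{leaves of j} |xᵢ|`, `u' = u/(1+u)`) closes the induction.
-/

namespace Literature.ComputerArithmetic.JeannerodRump2018

namespace SumTree

variable {p : ℕ} {emin : ℤ} {fl : ℚ → ℚ}

/-- `Σ|eᵢ|` over the internal nodes. [cite: JeannerodRump2018, Thm 4.1] -/
def absErr (fl : ℚ → ℚ) (t : SumTree) : ℚ := ((t.localErrors fl).map abs).sum

/-- `Σ|xᵢ|` over the leaves. [cite: JeannerodRump2018, Thm 4.1] -/
def absSum (t : SumTree) : ℚ := (t.leaves.map abs).sum

/-- A tree has at least one leaf. [cite: JeannerodRump2018, §4.1] -/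
theorem one_le_length_leaves : ∀ t : SumTree, 1 ≤ t.leaves.length
  | leaf _ => by simp [leaves]
  | node l r => by simp [leaves]; have := one_le_length_leaves l; omega

/-- `absSum ≥ 0`. [cite: JeannerodRump2018, Thm 4.1] -/
theorem absSum_nonneg (t : SumTree) : 0 ≤ absSum t :=
  List.sum_nonneg (by intro x hx; obtain ⟨y, -, rfl⟩ := List.mem_map.mp hx; exact abs_nonneg y)

/-- `absErr ≥ 0`. [cite: JeannerodRump2018, Thm 4.1] -/
theorem absErr_nonneg (fl : ℚ → ℚ) (t : SumTree) : 0 ≤ absErr fl t :=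
  List.sum_nonneg (by intro x hx; obtain ⟨y, -, rfl⟩ := List.mem_map.mp hx; exact abs_nonneg y)

/-- Structural equations at a node. [cite: JeannerodRump2018, App. B] -/
theorem absSum_node (l r : SumTree) : absSum (node l r) = absSum l + absSum r := by
  simp [absSum, leaves, List.map_append, List.sum_append]

/-- Structural equations at a node. [cite: JeannerodRump2018, App. B] -/
theorem absErr_node (fl : ℚ → ℚ) (l r : SumTree) : absErr fl (node l r)
    = absErr fl l + absErr fl r + |fl (eval fl l + eval fl r) - (eval fl l + eval fl r)| := by
  simp [absErr, localErrors, List.map_append, List.sum_append, add_assoc]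

/-- The evaluated sum is a float when the leaves are. [cite: JeannerodRump2018, App. B] -/
theorem isFloat_eval (hfl : IsRoundNearest p emin fl) :
    ∀ t : SumTree, (∀ x ∈ t.leaves, IsFloat p emin x) → IsFloat p emin (eval fl t)
  | leaf x, h => by simpa [eval, leaves] using h
  | node l r, _ => (hfl _).1

/-- `|exact| ≤ Σ|xᵢ|`. [cite: JeannerodRump2018, App. B] -/
theorem abs_exact_le_absSum : ∀ t : SumTree, |exact t| ≤ absSum t
  | leaf x => by simp [exact, absSum, leaves]
  | node l r => by
      rw [absSum_node]; simp only [exact]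
      exact le_trans (abs_add_le _ _) (add_le_add (abs_exact_le_absSum l) (abs_exact_le_absSum r))

/-- TELESCOPING: `|ŝ - s| ≤ Σ|eᵢ|`. [cite: JeannerodRump2018, eq. (1.3)] -/
theorem abs_eval_sub_exact_le (fl : ℚ → ℚ) : ∀ t : SumTree, |eval fl t - exact t| ≤ absErr fl t
  | leaf x => by simp [eval, exact, absErr, localErrors]
  | node l r => by
      have hl := abs_eval_sub_exact_le fl l
      have hr := abs_eval_sub_exact_le fl r
      rw [absErr_node]
      change |fl (eval fl l + eval fl r) - (exact l + exact r)| ≤ _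
      set e := fl (eval fl l + eval fl r) - (eval fl l + eval fl r) with he
      set dl := eval fl l - exact l with hdl
      set dr := eval fl r - exact r with hdr
      have key : fl (eval fl l + eval fl r) - (exact l + exact r) = e + (dl + dr) := by
        rw [he, hdl, hdr]; ring
      rw [key]
      have h1 : |e + (dl + dr)| ≤ |e| + (|dl| + |dr|) :=
        le_trans (abs_add_le _ _) (by
          have := abs_add_le dl dr
          linarith)
      linarith

/-- `|ŝ| ≤ Σ|xᵢ| + Σ|eᵢ|`. [cite: JeannerodRump2018, App. B] -/
theorem abs_eval_le (fl : ℚ → ℚ) (t : SumTree) : |eval fl t| ≤ absSum t + absErr fl t := by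
  have h1 := abs_eval_sub_exact_le fl t
  have h2 := abs_exact_le_absSum t
  rw [show eval fl t = (eval fl t - exact t) + exact t by ring]
  calc |(eval fl t - exact t) + exact t| ≤ |eval fl t - exact t| + |exact t| := abs_add_le _ _
    _ ≤ _ := by linarith

/-- THEOREM 4.1, tree form: `Σ|eᵢ| ≤ (n - 1)·u/(1+u)·Σ|xᵢ|` for every evaluation tree with leaves
in `F`. [cite: JeannerodRump2018, Thm 4.1] -/
theorem absErr_le (hp : 1 ≤ p) (hfl : IsRoundNearest p emin fl) :
    ∀ t : SumTree, (∀ x ∈ t.leaves, IsFloat p emin x) →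
      absErr fl t ≤ ((t.leaves.length : ℚ) - 1) * (unitRoundoff p / (1 + unitRoundoff p)) * absSum t
  | leaf x, _ => by simp [absErr, localErrors, leaves]
  | node l r, hleaves => by
      have hl : ∀ x ∈ l.leaves, IsFloat p emin x := fun x hx => hleaves x (by simp [leaves, hx])
      have hr : ∀ x ∈ r.leaves, IsFloat p emin x := fun x hx => hleaves x (by simp [leaves, hx])
      have ihl := absErr_le hp hfl l hl
      have ihr := absErr_le hp hfl r hr
      set u' := unitRoundoff p / (1 + unitRoundoff p) with hu'
      have hupos : 0 < unitRoundoff p := by unfold unitRoundoff; positivity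
      have hu'0 : 0 ≤ u' := div_nonneg hupos.le (by linarith)
      have hu'1 : u' ≤ 1 := by rw [hu', div_le_one (by linarith)]; linarith
      set S1 := absSum l; set S2 := absSum r
      set E1 := absErr fl l; set E2 := absErr fl r
      set n1 : ℚ := (l.leaves.length : ℚ) with hn1d
      set n2 : ℚ := (r.leaves.length : ℚ) with hn2d
      have hn1 : (1 : ℚ) ≤ n1 := by rw [hn1d]; exact_mod_cast one_le_length_leaves l
      have hn2 : (1 : ℚ) ≤ n2 := by rw [hn2d]; exact_mod_cast one_le_length_leaves r
      have hS1 := absSum_nonneg l; have hS2 := absSum_nonneg r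
      have hE1 := absErr_nonneg fl l; have hE2 := absErr_nonneg fl r
      -- the root error and its three bounds
      set e := |fl (eval fl l + eval fl r) - (eval fl l + eval fl r)| with he
      have hFl := isFloat_eval hfl l hl
      have hFr := isFloat_eval hfl r hr
      have b0 : e ≤ u' * |eval fl l + eval fl r| := abs_err_add_le_sharp hp hfl hFl hFr
      have b2 : e ≤ |eval fl r| := abs_err_le_abs_operand hfl hFl _
      have b1 : e ≤ |eval fl l| := by
        have := abs_err_le_abs_operand hfl hFr (eval fl l)
        rwa [add_comm (eval fl r)] at this
      have a1 := abs_eval_le fl l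
      have a2 := abs_eval_le fl r
      have b0' : e ≤ u' * (S1 + E1 + S2 + E2) :=
        le_trans b0 (mul_le_mul_of_nonneg_left
          (le_trans (abs_add_le _ _) (by linarith)) hu'0)
      -- bookkeeping of the node
      rw [absErr_node, absSum_node]
      have hlen : ((node l r).leaves.length : ℚ) = n1 + n2 := by
        simp [leaves, List.length_append]; rfl
      rw [hlen]
      show E1 + E2 + e ≤ (n1 + n2 - 1) * u' * (S1 + S2)
      -- three cases
      by_cases c1 : S2 < u' * S1
      · -- use e ≤ |ŝ2| ≤ S2 + E2
        have hb : e ≤ S2 + E2 := le_trans b2 a2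
        have t1 : 0 ≤ n2 * (u' * S1 - S2) := mul_nonneg (by linarith) (by linarith)
        have t2 : 0 ≤ S2 * ((n2 - 1) * (1 - u')) := mul_nonneg hS2 (mul_nonneg (by linarith) (by linarith))
        have t3 : 0 ≤ S2 * (n1 * u') := mul_nonneg hS2 (mul_nonneg (by linarith) hu'0)
        have i1 : E1 ≤ (n1 - 1) * u' * S1 := ihl
        have i2 : E2 ≤ (n2 - 1) * u' * S2 := ihr
        nlinarith
      by_cases c2 : S1 < u' * S2
      · have hb : e ≤ S1 + E1 := le_trans b1 a1
        have t1 : 0 ≤ n1 * (u' * S2 - S1) := mul_nonneg (by linarith) (by linarith)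
        have t2 : 0 ≤ S1 * ((n1 - 1) * (1 - u')) := mul_nonneg hS1 (mul_nonneg (by linarith) (by linarith))
        have t3 : 0 ≤ S1 * (n2 * u') := mul_nonneg hS1 (mul_nonneg (by linarith) hu'0)
        have i1 : E1 ≤ (n1 - 1) * u' * S1 := ihl
        have i2 : E2 ≤ (n2 - 1) * u' * S2 := ihr
        nlinarith
      · have c1' : u' * S1 ≤ S2 := not_lt.mp c1
        have c2' : u' * S2 ≤ S1 := not_lt.mp c2
        have t1 : 0 ≤ u' * ((n2 - 1) * (S1 - u' * S2)) :=
          mul_nonneg hu'0 (mul_nonneg (by linarith) (by linarith))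
        have t2 : 0 ≤ u' * ((n1 - 1) * (S2 - u' * S1)) :=
          mul_nonneg hu'0 (mul_nonneg (by linarith) (by linarith))
        have i1 : (1 + u') * E1 ≤ (1 + u') * ((n1 - 1) * u' * S1) :=
          mul_le_mul_of_nonneg_left ihl (by linarith)
        have i2 : (1 + u') * E2 ≤ (1 + u') * ((n2 - 1) * u' * S2) :=
          mul_le_mul_of_nonneg_left ihr (by linarith)
        nlinarith

end SumTree

/-- THEOREM 4.1 DISCHARGED. [cite: JeannerodRump2018, Thm 4.1] -/
theorem theorem41_holds : theorem41 := by
  intro p emin fl hp hfl t hleaves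
  have h := SumTree.absErr_le (le_trans (by norm_num) hp) hfl t hleaves
  have hn := SumTree.one_le_length_leaves t
  have hcast : ((t.leaves.length - 1 : ℕ) : ℚ) = (t.leaves.length : ℚ) - 1 := by
    rw [Nat.cast_sub hn]; simp
  unfold SumTree.absErr SumTree.absSum at h
  rw [hcast]; exact h

/-- Eq. (1.3) DISCHARGED: `|ŝ - s| ≤ (n-1)u/(1+u)·Σ|xᵢ|`, any order, with underflow.
[cite: JeannerodRump2018, eq. (1.3)] -/
theorem sumError_le_holds : sumError_le := by
  intro p emin fl hp hfl t hleaves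
  have h1 := SumTree.abs_eval_sub_exact_le fl t
  have h2 := theorem41_holds p emin fl hp hfl t hleaves
  unfold SumTree.absErr at h1
  exact le_trans h1 h2

end Literature.ComputerArithmetic.JeannerodRump2018
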